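import Summits.CriticalPhenomena.SAWScalingLimit.Theorems.SAWTotalPositivityBoundaryTP2Defs
import Summits.CriticalPhenomena.SAWScalingLimit.Theorems.SAWTotalPositivityBoundaryTP2Kernel
import Summits.CriticalPhenomena.SAWScalingLimit.Theorems.SAWTotalPositivityBoundaryTP2LadderKernelsInterior
import Summits.CriticalPhenomena.SAWScalingLimit.Theorems.EdgeOfPositivity.Negative.EdgeOfPositivityRectDomain
import HarnessLib

/-!
# Crux `BoundaryTP2` (stmt-CriticalPhenomena-7115), line `Sketch`: nested vs crossing pairing on the bottom row of a ladder

Tool stub `stub_ladder_bottomRow_nested` of the line's skeleton: on the ladder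
`R_L = discreteDomainGraph (rectDomain L 1) 1` (sites `{0..L} × {0,1}`), for four bottom sites
`(c₁,0), (c₂,0), (c₃,0), (c₄,0)` with `c₁ < c₂ < c₃ < c₄ ≤ L` and every fugacity `0 ≤ x ≤ 1/2`, the
crossing pairing weighs at most the nested one:

  `Z(c₁,c₃) Z(c₂,c₄) ≤ Z(c₁,c₄) Z(c₂,c₃)`,   `Z = pathKernel R_L x`.

Proof. By the landed two-point kernels of the ladder (`stub_ladderKernels_interior`) the bottom-row
kernel has the RANK-TWO form

  `Z(i,j) = x^{j-i}/2 · (a_i b_j (1+x)^{j-i-1} + a'_i b'_j (1-x)^{j-i-1})`,  `i < j`,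

with `a_i = 1+x+E_i`, `a'_i = 1-x-E_i`, `b_j = 1+x+E_{L-j}`, `b'_j = 1-x-E_{L-j}`,
`E_k = Σ_{d<k} x^{2d+3}` (`ladderNest_kernel`, a `ring` identity). Hence (Cauchy–Binet with inner
dimension two) the minor factors through the two "orientation determinants" of the clustered pairs:
with `u+1 = c₂-c₁`, `v+1 = c₃-c₂`, `w+1 = c₄-c₃`,

  `Z₁₄Z₂₃ - Z₁₃Z₂₄ = x^{u+2v+w+4}/4 · ((1+x)(1-x))^{v}
      · (a_{c₁} a'_{c₂} (1+x)^{u+1} - a'_{c₁} a_{c₂} (1-x)^{u+1})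
      · (b'_{c₃} b_{c₄} (1+x)^{w+1} - b_{c₃} b'_{c₄} (1-x)^{w+1})`

(`ring`), and both determinants are `≥ 0` for `0 ≤ x ≤ 1/2` (`ladderNest_orient`): using
`(1-x)^u ≤ (1+x)^u` one reduces to `u = 0`, where the difference is
`2x(1-x²) + 2E₁(1-x²) - 2E₂(1+x²) - 2xE₁E₂ ≥ 0` by the geometric bound `E_k (1-x²) = x³ - x^{2k+3} ≤ x³`
and `3x² ≤ 1`.  The assembly in `ℝ≥0∞` is `ENNReal.ofReal_mul` / `ENNReal.ofReal_le_ofReal`.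
-/

noncomputable section

namespace Summit.CriticalPhenomena.SAWScalingLimit.Theorems.BoundaryTP2

open Literature.Probability.LatticeModels Literature.Probability.RandomPlanarGeometry
open Summit.CriticalPhenomena.SAWScalingLimit.Theorems.EdgeOfPositivity.Negative
open scoped ENNReal

/-! ## The excursion sums `E_k = Σ_{d<k} x^{2d+3}` -/

/-- Geometric identity `E_k (1 - x²) = x³ - x^{2k+3}`. [folklore] -/
private theorem ladderNest_excursion_mul (x : ℝ) (k : ℕ) :
    (∑ d ∈ Finset.range k, x ^ (2 * d + 3)) * (1 - x ^ 2) = x ^ 3 - x ^ (2 * k + 3) := by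
  induction k with
  | zero => simp
  | succ k ih =>
    rw [Finset.sum_range_succ, add_mul, ih]
    ring

/-- Geometric bound `E_k (1 - x²) ≤ x³` for `x ≥ 0`. [folklore] -/
private theorem ladderNest_excursion_bound {x : ℝ} (hx : 0 ≤ x) (k : ℕ) :
    (∑ d ∈ Finset.range k, x ^ (2 * d + 3)) * (1 - x ^ 2) ≤ x ^ 3 := by
  rw [ladderNest_excursion_mul]
  linarith [pow_nonneg hx (2 * k + 3)]

/-- `E_k ≥ 0` for `x ≥ 0`. [folklore] -/
private theorem ladderNest_excursion_nonneg {x : ℝ} (hx : 0 ≤ x) (k : ℕ) :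
    0 ≤ ∑ d ∈ Finset.range k, x ^ (2 * d + 3) :=
  Finset.sum_nonneg fun _ _ => pow_nonneg hx _

/-- For `0 ≤ x ≤ 1/2` and `0 ≤ E` with `E (1-x²) ≤ x³` one has `E ≤ 1/6`, so `1 - x - E ≥ 0`. [folklore] -/
private theorem ladderNest_coef_nonneg {x E : ℝ} (hx0 : 0 ≤ x) (hx : x ≤ 1 / 2) (hE : 0 ≤ E)
    (hEb : E * (1 - x ^ 2) ≤ x ^ 3) : 0 ≤ 1 - x - E := by
  have hx2 : x ^ 2 ≤ (1 / 2) ^ 2 := pow_le_pow_left₀ hx0 hx 2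
  have hx3 : x ^ 3 ≤ (1 / 2) ^ 3 := pow_le_pow_left₀ hx0 hx 3
  norm_num at hx2 hx3
  have h1 : E * (3 / 4) ≤ E * (1 - x ^ 2) := mul_le_mul_of_nonneg_left (by linarith) hE
  linarith

/-! ## The orientation determinant of a clustered pair -/

/-- **Sign of the orientation determinant.** For `0 ≤ x ≤ 1/2`, `E₁, E₂ ≥ 0` with
`E₁ (1-x²) ≤ x³`, `E₂ (1-x²) ≤ x³`, and every `u`,
`(1-x-E₁)(1+x+E₂)(1-x)^{u+1} ≤ (1+x+E₁)(1-x-E₂)(1+x)^{u+1}`: by `(1-x)^u ≤ (1+x)^u` it suffices to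
treat `u = 0`, where `(1-x²)·(RHS - LHS) = 2(x(1-3x²) + E₁(1-2x²) + (x³-E₂(1-x²))(1+x²) + xE₁(x³-E₂(1-x²)))`
is a sum of nonnegative terms. [folklore] -/
private theorem ladderNest_orient {x E₁ E₂ : ℝ} (hx0 : 0 ≤ x) (hx : x ≤ 1 / 2) (hE₁ : 0 ≤ E₁)
    (hE₂ : 0 ≤ E₂) (hE₁b : E₁ * (1 - x ^ 2) ≤ x ^ 3) (hE₂b : E₂ * (1 - x ^ 2) ≤ x ^ 3) (u : ℕ) :
    0 ≤ (1 + x + E₁) * (1 - x - E₂) * (1 + x) ^ (u + 1) -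
      (1 - x - E₁) * (1 + x + E₂) * (1 - x) ^ (u + 1) := by
  have hx2 : x ^ 2 ≤ (1 / 2) ^ 2 := pow_le_pow_left₀ hx0 hx 2
  norm_num at hx2
  have ha₁ : 0 ≤ 1 - x - E₁ := ladderNest_coef_nonneg hx0 hx hE₁ hE₁b
  -- the case `u = 0`
  have hD : 0 ≤ (1 + x + E₁) * (1 - x - E₂) * (1 + x) - (1 - x - E₁) * (1 + x + E₂) * (1 - x) := by
    have h1x2 : 0 < 1 - x ^ 2 := by linarith
    have hE₂' : 0 ≤ x ^ 3 - E₂ * (1 - x ^ 2) := by linarith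
    have t1 : 0 ≤ x * (1 - 3 * x ^ 2) := mul_nonneg hx0 (by linarith)
    have t2 : 0 ≤ E₁ * (1 - 2 * x ^ 2) := mul_nonneg hE₁ (by linarith)
    have t3 : 0 ≤ (x ^ 3 - E₂ * (1 - x ^ 2)) * (1 + x ^ 2) := mul_nonneg hE₂' (by positivity)
    have t4 : 0 ≤ x * E₁ * (x ^ 3 - E₂ * (1 - x ^ 2)) := mul_nonneg (mul_nonneg hx0 hE₁) hE₂'
    have e : (1 - x ^ 2) * ((1 + x + E₁) * (1 - x - E₂) * (1 + x) -
        (1 - x - E₁) * (1 + x + E₂) * (1 - x)) =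
        2 * (x * (1 - 3 * x ^ 2) + E₁ * (1 - 2 * x ^ 2) + (x ^ 3 - E₂ * (1 - x ^ 2)) * (1 + x ^ 2) +
          x * E₁ * (x ^ 3 - E₂ * (1 - x ^ 2))) := by
      ring
    have key : 0 ≤ (1 - x ^ 2) * ((1 + x + E₁) * (1 - x - E₂) * (1 + x) -
        (1 - x - E₁) * (1 + x + E₂) * (1 - x)) := by
      rw [e]
      linarith
    exact (mul_nonneg_iff_of_pos_left h1x2).mp key
  -- general `u`
  have hMP : (1 - x) ^ u ≤ (1 + x) ^ u := pow_le_pow_left₀ (by linarith) (by linarith) u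
  have hb0 : 0 ≤ (1 - x - E₁) * (1 + x + E₂) * (1 - x) :=
    mul_nonneg (mul_nonneg ha₁ (by linarith)) (by linarith)
  have hP : 0 ≤ (1 + x) ^ u := pow_nonneg (by linarith) u
  have h1 : (1 - x - E₁) * (1 + x + E₂) * (1 - x) * (1 - x) ^ u ≤
      (1 - x - E₁) * (1 + x + E₂) * (1 - x) * (1 + x) ^ u := mul_le_mul_of_nonneg_left hMP hb0
  have h2 : (1 - x - E₁) * (1 + x + E₂) * (1 - x) * (1 + x) ^ u ≤
      (1 + x + E₁) * (1 - x - E₂) * (1 + x) * (1 + x) ^ u :=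
    mul_le_mul_of_nonneg_right (sub_nonneg.mp hD) hP
  rw [pow_succ, pow_succ]
  nlinarith [h1, h2]

/-! ## The rank-two form of the bottom-row kernels and the factorised minor -/

/-- **Rank-two form of the bottom-row kernels.** For `j = i + n + 1 ≤ L` and `x ≥ 0`,
`Z_{R_L}((i,0),(j,0)) = x^{n+1}/2 · ((1+x+E_i)(1+x+E_{L-j})(1+x)^n + (1-x-E_i)(1-x-E_{L-j})(1-x)^n)`,
a regrouping of `stub_ladderKernels_interior`. [folklore] -/
private theorem ladderNest_kernel (L i j n : ℕ) (hj : j = i + n + 1) (hjL : j ≤ L) {x : ℝ} (hx : 0 ≤ x) :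
    pathKernel (discreteDomainGraph (rectDomain L 1) 1) x (st i 0) (st j 0) =
      ENNReal.ofReal (x ^ (n + 1) / 2 *
        ((1 + x + ∑ d ∈ Finset.range i, x ^ (2 * d + 3)) *
              (1 + x + ∑ d ∈ Finset.range (L - j), x ^ (2 * d + 3)) * (1 + x) ^ n +
          (1 - x - ∑ d ∈ Finset.range i, x ^ (2 * d + 3)) *
              (1 - x - ∑ d ∈ Finset.range (L - j), x ^ (2 * d + 3)) * (1 - x) ^ n)) := by
  rw [stub_ladderKernels_interior L i j (by omega) hjL hx 0 0 (Or.inl rfl) (Or.inl rfl), if_pos rfl]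
  congr 1
  have e1 : j - i = n + 1 := by omega
  rw [e1, Nat.add_sub_cancel]
  ring

/-- **The factorised minor.** With `Eₖ` standing for `E_{c₁}, E_{c₂}, E_{L-c₃}, E_{L-c₄}` and the gaps
`u+1, v+1, w+1`, the real inequality `K₁₃ K₂₄ ≤ K₁₄ K₂₃` between the rank-two forms: the difference
`K₁₄K₂₃ - K₁₃K₂₄` is `x^{u+2v+w+4}/4 · (1+x)^v (1-x)^v` times the product of the two orientation
determinants, each nonnegative by `ladderNest_orient`. [folklore] -/
private theorem ladderNest_real {x E₁ E₂ E₃ E₄ : ℝ} (hx0 : 0 ≤ x) (hx : x ≤ 1 / 2)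
    (hE₁ : 0 ≤ E₁) (hE₂ : 0 ≤ E₂) (hE₃ : 0 ≤ E₃) (hE₄ : 0 ≤ E₄)
    (hE₁b : E₁ * (1 - x ^ 2) ≤ x ^ 3) (hE₂b : E₂ * (1 - x ^ 2) ≤ x ^ 3)
    (hE₃b : E₃ * (1 - x ^ 2) ≤ x ^ 3) (hE₄b : E₄ * (1 - x ^ 2) ≤ x ^ 3) (u v w : ℕ) :
    x ^ (u + v + 1 + 1) / 2 * ((1 + x + E₁) * (1 + x + E₃) * (1 + x) ^ (u + v + 1) +
          (1 - x - E₁) * (1 - x - E₃) * (1 - x) ^ (u + v + 1)) *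
        (x ^ (v + w + 1 + 1) / 2 * ((1 + x + E₂) * (1 + x + E₄) * (1 + x) ^ (v + w + 1) +
          (1 - x - E₂) * (1 - x - E₄) * (1 - x) ^ (v + w + 1))) ≤
      x ^ (u + v + w + 2 + 1) / 2 * ((1 + x + E₁) * (1 + x + E₄) * (1 + x) ^ (u + v + w + 2) +
          (1 - x - E₁) * (1 - x - E₄) * (1 - x) ^ (u + v + w + 2)) *
        (x ^ (v + 1) / 2 * ((1 + x + E₂) * (1 + x + E₃) * (1 + x) ^ v +
          (1 - x - E₂) * (1 - x - E₃) * (1 - x) ^ v)) := by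
  have hl := ladderNest_orient hx0 hx hE₁ hE₂ hE₁b hE₂b u
  have hr := ladderNest_orient hx0 hx hE₄ hE₃ hE₄b hE₃b w
  rw [← sub_nonneg]
  have key : x ^ (u + v + w + 2 + 1) / 2 * ((1 + x + E₁) * (1 + x + E₄) * (1 + x) ^ (u + v + w + 2) +
          (1 - x - E₁) * (1 - x - E₄) * (1 - x) ^ (u + v + w + 2)) *
        (x ^ (v + 1) / 2 * ((1 + x + E₂) * (1 + x + E₃) * (1 + x) ^ v +
          (1 - x - E₂) * (1 - x - E₃) * (1 - x) ^ v)) -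
      x ^ (u + v + 1 + 1) / 2 * ((1 + x + E₁) * (1 + x + E₃) * (1 + x) ^ (u + v + 1) +
          (1 - x - E₁) * (1 - x - E₃) * (1 - x) ^ (u + v + 1)) *
        (x ^ (v + w + 1 + 1) / 2 * ((1 + x + E₂) * (1 + x + E₄) * (1 + x) ^ (v + w + 1) +
          (1 - x - E₂) * (1 - x - E₄) * (1 - x) ^ (v + w + 1))) =
      x ^ (u + 2 * v + w + 4) / 4 * ((1 + x) ^ v * (1 - x) ^ v) *
        ((1 + x + E₄) * (1 - x - E₃) * (1 + x) ^ (w + 1) -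
          (1 - x - E₄) * (1 + x + E₃) * (1 - x) ^ (w + 1)) *
        ((1 + x + E₁) * (1 - x - E₂) * (1 + x) ^ (u + 1) -
          (1 - x - E₁) * (1 + x + E₂) * (1 - x) ^ (u + 1)) := by
    ring
  rw [key]
  have hPM : 0 ≤ (1 + x) ^ v * (1 - x) ^ v :=
    mul_nonneg (pow_nonneg (by linarith) v) (pow_nonneg (by linarith) v)
  exact mul_nonneg (mul_nonneg (mul_nonneg (by positivity) hPM) hr) hl

/-! ## The stub -/

/-- **Tool stub `stub_ladder_bottomRow_nested`.** On the ladder `{0..L}×{0,1}`, for bottom sites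
`c₁ < c₂ < c₃ < c₄ ≤ L` and `0 ≤ x ≤ 1/2`: the crossing pairing weighs at most the NESTED one,
`Z₁₃ Z₂₄ ≤ Z₁₄ Z₂₃`. Mechanism: in the rank-two form of the ladder kernel the minor `Z₁₄Z₂₃ - Z₁₃Z₂₄`
is `x^{c₃+c₄-c₁-c₂}/4 · ((1+x)(1-x))^{c₃-c₂-1}` times the product of the left orientation determinant
`a_{c₁}a'_{c₂}(1+x)^{c₂-c₁} - a'_{c₁}a_{c₂}(1-x)^{c₂-c₁} ≥ 0` and the right one
`b'_{c₃}b_{c₄}(1+x)^{c₄-c₃} - b_{c₃}b'_{c₄}(1-x)^{c₄-c₃} ≥ 0` (both signs from `3x² ≤ 1` and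
`E_k (1-x²) ≤ x³`). [folklore] -/
theorem stub_ladder_bottomRow_nested (L : ℕ) {c₁ c₂ c₃ c₄ : ℕ} (h₁₂ : c₁ < c₂) (h₂₃ : c₂ < c₃) (h₃₄ : c₃ < c₄)
    (h₄ : c₄ ≤ L) {x : ℝ} (hx0 : 0 ≤ x) (hx : x ≤ 1 / 2) :
    pathKernel (discreteDomainGraph (rectDomain L 1) 1) x (st c₁ 0) (st c₃ 0) *
        pathKernel (discreteDomainGraph (rectDomain L 1) 1) x (st c₂ 0) (st c₄ 0) ≤
      pathKernel (discreteDomainGraph (rectDomain L 1) 1) x (st c₁ 0) (st c₄ 0) *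
        pathKernel (discreteDomainGraph (rectDomain L 1) 1) x (st c₂ 0) (st c₃ 0) := by
  obtain ⟨u, hu⟩ : ∃ u, c₂ = c₁ + u + 1 := ⟨c₂ - c₁ - 1, by omega⟩
  obtain ⟨v, hv⟩ : ∃ v, c₃ = c₂ + v + 1 := ⟨c₃ - c₂ - 1, by omega⟩
  obtain ⟨w, hw⟩ : ∃ w, c₄ = c₃ + w + 1 := ⟨c₄ - c₃ - 1, by omega⟩
  rw [ladderNest_kernel L c₁ c₃ (u + v + 1) (by omega) (by omega) hx0,
    ladderNest_kernel L c₂ c₄ (v + w + 1) (by omega) h₄ hx0,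
    ladderNest_kernel L c₁ c₄ (u + v + w + 2) (by omega) h₄ hx0,
    ladderNest_kernel L c₂ c₃ v (by omega) (by omega) hx0]
  have hE₁ := ladderNest_excursion_nonneg hx0 c₁
  have hE₂ := ladderNest_excursion_nonneg hx0 c₂
  have hE₃ := ladderNest_excursion_nonneg hx0 (L - c₃)
  have hE₄ := ladderNest_excursion_nonneg hx0 (L - c₄)
  have hE₁b := ladderNest_excursion_bound hx0 c₁
  have hE₂b := ladderNest_excursion_bound hx0 c₂
  have hE₃b := ladderNest_excursion_bound hx0 (L - c₃)
  have hE₄b := ladderNest_excursion_bound hx0 (L - c₄)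
  have ha₁ := ladderNest_coef_nonneg hx0 hx hE₁ hE₁b
  have ha₃ := ladderNest_coef_nonneg hx0 hx hE₃ hE₃b
  have ha₄ := ladderNest_coef_nonneg hx0 hx hE₄ hE₄b
  have h1x : 0 ≤ 1 - x := by linarith
  have h13 : 0 ≤ x ^ (u + v + 1 + 1) / 2 *
      ((1 + x + ∑ d ∈ Finset.range c₁, x ^ (2 * d + 3)) *
            (1 + x + ∑ d ∈ Finset.range (L - c₃), x ^ (2 * d + 3)) * (1 + x) ^ (u + v + 1) +
        (1 - x - ∑ d ∈ Finset.range c₁, x ^ (2 * d + 3)) *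
            (1 - x - ∑ d ∈ Finset.range (L - c₃), x ^ (2 * d + 3)) * (1 - x) ^ (u + v + 1)) :=
    mul_nonneg (by positivity) (add_nonneg (by positivity)
      (mul_nonneg (mul_nonneg ha₁ ha₃) (pow_nonneg h1x _)))
  have h14 : 0 ≤ x ^ (u + v + w + 2 + 1) / 2 *
      ((1 + x + ∑ d ∈ Finset.range c₁, x ^ (2 * d + 3)) *
            (1 + x + ∑ d ∈ Finset.range (L - c₄), x ^ (2 * d + 3)) * (1 + x) ^ (u + v + w + 2) +
        (1 - x - ∑ d ∈ Finset.range c₁, x ^ (2 * d + 3)) *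
            (1 - x - ∑ d ∈ Finset.range (L - c₄), x ^ (2 * d + 3)) * (1 - x) ^ (u + v + w + 2)) :=
    mul_nonneg (by positivity) (add_nonneg (by positivity)
      (mul_nonneg (mul_nonneg ha₁ ha₄) (pow_nonneg h1x _)))
  rw [← ENNReal.ofReal_mul h13, ← ENNReal.ofReal_mul h14]
  exact ENNReal.ofReal_le_ofReal
    (ladderNest_real hx0 hx hE₁ hE₂ hE₃ hE₄ hE₁b hE₂b hE₃b hE₄b u v w)

end Summit.CriticalPhenomena.SAWScalingLimit.Theorems.BoundaryTP2
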